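import Summits.AtomisticToContinuum.HydrodynamicLimit.Theorems.BoxDissipativeWeakStrongRelativeEnergyStabilityClampChoice
import Summits.AtomisticToContinuum.HydrodynamicLimit.Theorems.BoxDissipativeWeakStrongRelativeEnergyStabilityTimeZero
import Summits.AtomisticToContinuum.HydrodynamicLimit.Theorems.BoxDissipativeWeakStrongRelativeEnergyStabilityBalanceLaws
import Summits.AtomisticToContinuum.HydrodynamicLimit.Theorems.BoxDissipativeWeakStrongRelativeEnergyStabilityEnergyMoment
import Summits.AtomisticToContinuum.HydrodynamicLimit.Theorems.BoxDissipativeWeakStrongRelativeEnergyStabilityCutEosMaster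
import Summits.AtomisticToContinuum.HydrodynamicLimit.Theorems.BoxDissipativeWeakStrongRelativeEnergyStabilityCoercive
import Summits.AtomisticToContinuum.HydrodynamicLimit.Theorems.BoxDissipativeWeakStrongRelativeEnergyStabilityForcedGronwall
import Summits.AtomisticToContinuum.HydrodynamicLimit.Theorems.BoxDissipativeWeakStrongRelativeEnergyStabilityFlowJointMeasurable
import Summits.AtomisticToContinuum.HydrodynamicLimit.Theorems.BoxDissipativeWeakStrongRelativeEnergyStabilityGronwall

/-!
# Skeleton of the crux `RelativeEnergyStability` (stmt-AtomisticToContinuum-17653), line `registered`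
# (birth skeleton, RESHAPED by the line lead 2026-08-17 to the CLAMPED currency)

Route `route-AtomisticToContinuum-BoxDissipativeWeakStrong`, crux decl
`Summit.AtomisticToContinuum.HydrodynamicLimit.Theses.BoxDissipativeWeakStrong.RelativeEnergyStability`
(`FluxClosure → EntropyAdmissibility → ⟨LocalGibbsFineScale, inlined, with 0 < T⟩ → ⟨HsEosLowDensity,
inlined⟩ → ⟨the packing-guarded conjunct on every band η₁ < η_c, guard ρσ³ ≤ η₁/2⟩`).

## Why the reshape (lead, 2026-08-17)

The birth skeleton organised the Březina–Feireisl argument around the FULL box relative energy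
`∫⁻ ofReal(∫ ℰ_cut(Û | ρ,u,θ) dx) dP_N`. Its Grönwall stub then silently needs uniform integrability of the
box ENTROPY on cold boxes at POSITIVE times (`E_P ∫ ρ̂ |log θ̂| 1{cold} → 0`), which neither `FluxClosure`
nor `EntropyAdmissibility` supplies (refuter rreview-0815T14-10, note (ii): BF's entropy minimum principle is
false pathwise for box entropies). BF themselves never control the full relative energy: they control the
CLAMPED functional `ℰ_{Z_{a,b}}` (BF (3.3)–(3.4), in tree as `StrongPointData.relEnergyZ`) and un-clamp it
only through the a.s. minimum principle. The reshape makes `ℰ_{Z_{a,b}}` itself the currency of the line,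
with a DEEP lower clamp `a` (so deep that `μ_cut(r,Θ) + Θ a ≤ -1` along the strong solution): then

* on `{ŝ ≥ a}` the clamped energy dominates the full one (coercive), on `{ŝ < a}` it is
  `≥ ½ρ̂|v̂-U|² + ρ̂ê + ρ̂ + p_cut(r,Θ)` (coercive again), on vacuum it is `p_cut(r,Θ) > 0`, and Lean's
  junk on frozen boxes (`θ̂ = 0 < ρ̂`, `log 0 = 0`) costs at most `C ρ̂`, i.e. `C/((N+1)ℓ³) → 0` on the
  only frozen boxes of positive Liouville measure (one-particle boxes);
* the clamped functional is dominated by `C(1 + ρ̂ + ‖m̂‖ + Ê)`, so `e_N(0) → 0` follows from the `L¹`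
  convergence of the box fields by dominated convergence — NO uniform integrability of the entropy, no
  cluster expansion (this kills the crux's named risk "e_N(0) → 0 needs UI of box entropy");
* the Grönwall inequality closes on `{ŝ < a}` without un-clamping, because there
  `reducedRHS ≤ C(ρ̂|v̂-U|² + 1 + ρ̂ê + ρ̂) ≤ C' ℰ_Z`.

Stubs (7 = stubs_max, plus the XS Defs anchor `clampAdmissible_mono` closed by the Defs file; composition
`RelativeEnergyStability_of` sorry-free):

* `stub_clampChoice` (S0, compactness, size S–M): deep admissible clamps `a < b` exist for every classical
  solution with the guard on every `[0,τ] ⊂ [0,T)`.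
* `stub_clampedRelEnergyTimeZero` (S1', measure theory, size M⁻): `L¹` box fields at `t = 0` ⇒ clamped
  energy vanishes at `t = 0` (dominated convergence; `P_N(univ) ≤ 1`).
* `stub_boxBalanceLaws` (S-B, trajectories, size M): on the good set of the flow the box mass is `1`, the
  box energy is conserved, and the box continuity equation tested with any smooth `φ(t,x)` holds exactly
  (FTC for right derivatives along hard-sphere trajectories; `K_ℓ * ∇φ = ∇(K_ℓ * φ)`).
* `stub_cutEosMaster` (S-M, real analysis, size M–L): BF's master pointwise inequality
  `reducedRHS ≤ C ℰ_Z` for the CUT hard-sphere law with a deep clamp, on vacuum and on the open quadrant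
  (near the strong range the cut law is the smooth band extension of `JParityClosureParityInBandEosExtension`,
  so the in-tree essential estimate transfers; the residual/cold regions are explicit for the monatomic law).
* `stub_localGibbsEnergyMoment` (S-E, Gaussian velocities, size S–M): `E_{P_N}[KE/(N+1)] ≤ C(profiles)`.
* `stub_clampedRelEnergyGronwall` (S-X, THE HEART, lead's own): S-B → S-M → S-E → `FluxClosure` →
  `EntropyAdmissibility` → EOS fact → clamped energy vanishing propagates from `0` to every `τ < T`
  (BF §3.2 in expectation: test K1 with `w = u`, K2 with `φ = θ`, exact continuity with `φ₁`, exact energy,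
  `rawRHS = reducedRHS - div(pU)`, master inequality a.s., Grönwall with pointwise-in-`τ` `o(1)` forcing).
* `stub_clampedRelEnergyCoercive` (S3', convex analysis + Markov, size M): clamped energy vanishing at `t`
  ⇒ `TendstoHydroFieldsAt` at `t` (explicit Bregman coercivity of the monatomic cut law, frozen boxes are
  one-particle boxes a.s., `|⟨U_N,χ⟩ - ∫Û_N χ| ≤ ω_χ(ℓ)·(mass, energy)`).

STATUS (lead, 2026-08-17 evening): ALL STUBS LANDED — the skeleton is sorry-free. S0 p149850, S1' p152609, S-B p154086,
S-M p157075, S-E p154650, S3' p159980, S-G p161091, S-J p161332 and the heart S-X p169036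
(`Theorems/BoxDissipativeWeakStrongRelativeEnergyStabilityGronwall.lean`, assembled from the landed helper files
`…RelativeEnergyStabilityGronwall{Unpack,Strong,Pointwise,IntegrableAlong,IntegrableAlongB,IntegrablePieces,AeDistinct,
PathwiseA,PathwiseB,KMeas,ObsMeas,Bounds,MasterConst,Expect,Prelim}.lean`).

Disproof used: none exists for this crux (`ledger crux ls`: no Disproof.lean, 2026-08-17).
-/

noncomputable section

open MeasureTheory Filter Set
open scoped ENNReal Topology

namespace Summit.AtomisticToContinuum.HydrodynamicLimit.Cruxes.RelativeEnergyStability.Birth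

open Literature.MathematicalPhysics.KineticTheory Literature.Analysis.FluidPDE
open Literature.Analysis.FluidPDE.CompressibleEuler
open Literature.Analysis.FluidPDE.CompressibleEuler.EulerPhase
open Literature.Analysis.FunctionSpaces
open Summit.AtomisticToContinuum.HydrodynamicLimit.Theses
open Summit.AtomisticToContinuum.HydrodynamicLimit.Theses.BoxDissipativeWeakStrong
open Summit.AtomisticToContinuum.HydrodynamicLimit.Theorems.RES

/-! ## §0 Objects of the line

All objects and predicates (`boxKernel`, `boxState`, `boxPhase`, `cutExcessFreeEnergy`, `cutCompressibility`, `cutEOS`,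
`strongData`, `clampedRelEnergy`, `clampedRelEnergyObs`, `IsKineticWindow`, `BoxFieldsL1At`,
`BoxClampedRelEnergyVanishesAt`, `ClampAdmissible`, `BoxBalanceLawsFor`, `CutEosMasterFor`, `EnergyMomentFor`) are
LANDED in `Theorems/BoxDissipativeWeakStrongRelativeEnergyStabilityDefs.lean` (p147716, namespace `…Theorems.RES`,
opened below) — byte for byte the objects this skeleton was registered with. -/

/-! ## §1 Registered stubs — status 2026-08-17 wave 1: ALL LANDED except the heart `stub_clampedRelEnergyGronwall` (lead)

Signatures are EXPLICIT over the objects above (which are, byte for byte, the objects of the route Defs file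
`Theorems/BoxDissipativeWeakStrongRelativeEnergyStabilityDefs.lean`, namespace `…Theorems.RES`, proposed by the
lead); a stub file `Theorems/BoxDissipativeWeakStrongRelativeEnergyStability<Stub>.lean` imports that Defs file,
`open`s `…Theorems.RES` and repeats the header below verbatim. -/

/-- **Defs anchor (XS; closed by the Defs file itself).** Admissibility on `[0,τ]` restricts to `[0,τ']` for
`τ' ≤ τ` — the one lemma of the Defs file, registered so that the Defs file lands `--supports` this crux. -/
theorem clampAdmissible_mono {σ η₁ a b : ℝ} {ρ θ : ℝ → T3 → ℝ} {τ τ' : ℝ} (h : ClampAdmissible σ η₁ a b ρ θ τ) (hτ : τ' ≤ τ) : ClampAdmissible σ η₁ a b ρ θ τ' :=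
  -- LANDED p147716 (Defs anchor), `Theorems/BoxDissipativeWeakStrongRelativeEnergyStabilityDefs.lean`
  Summit.AtomisticToContinuum.HydrodynamicLimit.Theorems.RES.clampAdmissible_mono h hτ

/-- **S0 — admissible deep clamps exist (compactness; size S–M).** Given the EOS fact there is `ηe > 0` such
that for every band `0 < η₁ < ηe`, every `σ > 0`, every classical hard-sphere Euler solution on `[0,T)` obeying
the guard `ρσ³ ≤ η₁/2` and every `τ ∈ [0,T)`, some `a < b` are `ClampAdmissible` on `[0,τ]`.
Proof idea: `K = (ρ,θ)([0,τ] × 𝕋³)` is compact in `{r > 0, rσ³ ≤ η₁/2, Θ > 0}` (joint continuity on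
`Ico 0 T ⊇ Icc 0 τ`); a closed `δ`-thickening stays in `{r > 0, rσ³ < η₁, Θ > 0}`, where `s_cut` and `μ_cut`
are continuous (`hsExcessFreeEnergy = F` analytic on `[0,η₀) ⊇ [0,η₁]`, take `ηe ≤ η₀`); put
`b = 1 + max s_cut`, `a = min (min s_cut - 1) (-(2 + max |μ_cut|)/min Θ)` over the thickening. -/
theorem stub_clampChoice :
    HsEosLowDensity →
      ∃ ηe : ℝ, 0 < ηe ∧ ∀ η₁ : ℝ, 0 < η₁ → η₁ < ηe → ∀ σ : ℝ, 0 < σ →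
        ∀ (T : ℝ) (ρ θ : ℝ → T3 → ℝ) (u : ℝ → T3 → V3), IsHardSphereEulerSolution σ T ρ u θ →
          (∀ t ∈ Ico 0 T, ∀ x, ρ t x * σ ^ 3 ≤ η₁ / 2) →
          ∀ τ ∈ Ico 0 T, ∃ a b : ℝ, ClampAdmissible σ η₁ a b ρ θ τ :=
  -- LANDED p149850 (wave 1), `Theorems/BoxDissipativeWeakStrongRelativeEnergyStabilityClampChoice.lean`
  Summit.AtomisticToContinuum.HydrodynamicLimit.Theorems.RES.stub_clampChoice

/-- **S1' — the clamped box relative energy vanishes at time zero (dominated convergence; size M⁻).**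
For `0 < σ ≤ 1/2` (so that `P_N` is a probability measure, `isProbabilityMeasure_localGibbsLaw`), continuous
positive profiles, a classical solution on `[0,T)` with `0 < T`, any flow family, any kinetic window and
clamps admissible at `τ = 0`: `L¹(P_N ⊗ dx)` convergence of the box fields at `t = 0` implies
`E_P ofReal(∫ ℰ_Z dx) → 0` at `t = 0`. Why true: `|ℰ_Z(U | d)| ≤ C(1 + ρ̂ + ‖m̂‖ + Ê)` (clamped entropy is
bounded; `½|m̂|²/ρ̂ + Ê_int = Ê` identically for `boxPhase`), `ℰ_Z(· | d)` is continuous at the strong state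
with value `0` there (clamp inactive, `e = 3Θ/2`), the strong data at `t = 0` are continuous on compact `𝕋³`;
split `{|Û − U| ≤ δ} ∪ {> δ}` and use `1{|Δ| > δ} ≤ |Δ|/δ`; `P_N(univ) ≤ 1`. No Gibbs structure needed. -/
theorem stub_clampedRelEnergyTimeZero :
    HsEosLowDensity →
      ∃ ηa : ℝ, 0 < ηa ∧ ∀ η₁ : ℝ, 0 < η₁ → η₁ < ηa →
        ∀ (a₀ θ₀ : T3 → ℝ) (u₀ : T3 → V3), Continuous a₀ → Continuous θ₀ → Continuous u₀ →
          (∀ x, 0 < a₀ x) → (∀ x, 0 < θ₀ x) →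
          ∀ σ : ℝ, 0 < σ → σ ≤ 1 / 2 →
            ∀ (T : ℝ) (ρ θ : ℝ → T3 → ℝ) (u : ℝ → T3 → V3), IsHardSphereEulerSolution σ T ρ u θ → 0 < T →
              ∀ Φ : (N : ℕ) → HardSphereFlow (Literature.Analysis.FluidPDE.Torus.geometry (Fin 3))
                  (hsDiameter σ N) (N + 1),
                ∀ ℓ : ℕ → ℝ, IsKineticWindow ℓ →
                  ∀ a b : ℝ, ClampAdmissible σ η₁ a b ρ θ 0 →
                    BoxFieldsL1At σ a₀ u₀ θ₀ Φ ρ u θ ℓ 0 →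
                      BoxClampedRelEnergyVanishesAt σ η₁ a b a₀ u₀ θ₀ Φ ρ u θ ℓ 0 :=
  -- LANDED p152609 (+ helpers p151976; wave 1), `Theorems/BoxDissipativeWeakStrongRelativeEnergyStabilityTimeZero.lean`
  Summit.AtomisticToContinuum.HydrodynamicLimit.Theorems.RES.stub_clampedRelEnergyTimeZero

/-- **S-B — exact pathwise balance laws of the box fields on the good set (trajectories; size M).**
For `σ > 0`, a flow `Φ` of `N+1` spheres, a window `0 < l ≤ 1` and `z ∈ Φ.good`: `BoxBalanceLawsFor σ N Φ l z`,
i.e. box mass `1` (`∫ K_l(x,y) dx = 1`), box energy `= KE(Φ_t z)/(N+1)`, `KE` conserved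
(`HardSphereFlow.configEnergy_flow`), and the box continuity equation tested with any smooth `φ(t,x)` holds
EXACTLY with an integrable time integrand. Why true: `∫ ρ̂(t,x) φ(t,x) dx = (N+1)⁻¹ Σ_k (K_l ∗ φ_t)(x_k(t))`
with `K_l ∗ φ_t` a `C¹` function of the particle position whose torus gradient is `K_l ∗ ∇φ_t`; positions are
continuous and right-differentiable with right derivative the (right-continuous) velocity
(`IsHardSphereTrajectory.free`, locally finite collisions), so `t ↦ ∫ρ̂φ` is continuous on `[0,τ]` with a
bounded right derivative everywhere — FTC for right derivatives
(`intervalIntegral.integral_eq_sub_of_hasDeriv_right_of_le`); cf. `AnnealedZeroHorizonMassContinuity`. -/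
theorem stub_boxBalanceLaws :
    ∀ σ : ℝ, 0 < σ → ∀ (N : ℕ)
      (Φ : HardSphereFlow (Literature.Analysis.FluidPDE.Torus.geometry (Fin 3)) (hsDiameter σ N) (N + 1))
      (l : ℝ), 0 < l → l ≤ 1 → ∀ z ∈ Φ.good, BoxBalanceLawsFor σ N Φ l z :=
  -- LANDED p154086 (wave 1), `Theorems/BoxDissipativeWeakStrongRelativeEnergyStabilityBalanceLaws.lean`
  Summit.AtomisticToContinuum.HydrodynamicLimit.Theorems.RES.stub_boxBalanceLaws

/-- **S-M — BF's master pointwise inequality for the cut law with a deep clamp (real analysis; size M–L).**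
Given the EOS fact there is `ηm > 0` such that `CutEosMasterFor σ η₁` holds for every band `0 < η₁ < ηm` and
`σ > 0`. Why true (BF §3.2.2 (3.9)–(3.11) + the deep clamp): near `K` (the `δ`-box, inside the band interior)
the clamp is inactive and the cut law coincides with the smooth band extension `EulerEOS.monatomicExcess χ f`
of `exists_hsEos_band_extension` (`IsGibbs`, `C²`, stable, growth; its band edge is independent of `σ`, take
`ηm` below it), so `ℰ_Z = relEnergyFull` and the in-tree essential estimate (`master_pointwise_inequality` /
`reducedRHS_le_essential`) transfers; far from `K` with `ŝ ≥ a` one has `ℰ_Z ≥ relEnergyFull_cut`, which for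
the monatomic cut law is EXPLICITLY `½ρ|v|² + 3/2 ρΘ g(θ/Θ) + Θ·Bregman_φ(ρ | r)` (`g(x) = x − 1 − log x`,
`φ(ρ) = ρ log ρ + ρ F_cut(ρσ³)` convex with `φ'' ≥ z_min/ρ` since `(η Z_cut(η))' ≥ z_min > 0` for `η₁ < ηm`),
hence `≥ c·max(1, ρ, ρθ)` there, while `|reducedRHS| ≤ C(ρ|v|² + 1 + ρ + ρθ)` (clamped entropy bounded,
`p_cut ≤ Z(η₁)ρθ`); on `{ŝ < a}` the deep clamp gives `ℰ_Z ≥ ½ρ|v|² + 3/2 ρθ + ρ + p_cut(r,Θ)` directly; on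
vacuum `ℰ_Z = p_cut(r,Θ) ≥ p_min > 0` and `reducedRHS = p divU + ∂ₜp + U·∇p` is bounded. -/
theorem stub_cutEosMaster :
    HsEosLowDensity →
      ∃ ηm : ℝ, 0 < ηm ∧ ∀ η₁ : ℝ, 0 < η₁ → η₁ < ηm → ∀ σ : ℝ, 0 < σ → CutEosMasterFor σ η₁ :=
  -- LANDED p157075 (+ helpers p156463 p156491; wave 1), `Theorems/BoxDissipativeWeakStrongRelativeEnergyStabilityCutEosMaster.lean`
  Summit.AtomisticToContinuum.HydrodynamicLimit.Theorems.RES.stub_cutEosMaster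

/-- **S-E — the local Gibbs law has bounded mean kinetic energy per particle (Gaussian velocities; size S–M).**
For continuous positive profiles, `EnergyMomentFor a₀ u₀ θ₀`: a finite `C` bounds `E_{P_N}[KE(z)/(N+1)]` for
every `σ > 0`, `N` and flow (given the positions, velocities are independent Maxwellians `M_{1,u₀(xᵢ),θ₀(xᵢ)}`,
so `E[|vᵢ|²/2 | positions] = |u₀(xᵢ)|²/2 + 3θ₀(xᵢ)/2`), and `P_N(univ) ≤ 1` always (`= 0` when the spheres do
not fit). Toolbox: `HardSphereEulerProofs` (`localGibbsLaw_eq`, `velMeasure`, `integral_energy_gaussMeasure`,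
`lintegral_localGibbsMeasure_le_of_vel`, `localGibbsMeasure_univ`). -/
theorem stub_localGibbsEnergyMoment :
    ∀ (a₀ θ₀ : T3 → ℝ) (u₀ : T3 → V3), Continuous a₀ → Continuous θ₀ → Continuous u₀ →
      (∀ x, 0 < a₀ x) → (∀ x, 0 < θ₀ x) → EnergyMomentFor a₀ u₀ θ₀ :=
  -- LANDED p154650 (wave 1), `Theorems/BoxDissipativeWeakStrongRelativeEnergyStabilityEnergyMoment.lean`
  Summit.AtomisticToContinuum.HydrodynamicLimit.Theorems.RES.stub_localGibbsEnergyMoment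

/-- **S-G — Grönwall with pointwise `o(1)` forcing (real analysis; size S).** For uniformly bounded measurable
`f_N` on `[0,τ]` with `f_N(t) ≤ f_N(0) + C∫₀ᵗ f_N + err_N(t)`, `err_N(t) → 0` for each `t` (no measurability or bound on
`err` is assumed) and `f_N(0) → 0`: `limsup_N f_N(t) ≤ 0` at every `t ∈ [0,τ]`. Why true: `ẽ_N(t) := f_N(t) − f_N(0) − C∫₀ᵗf_N`
is measurable, `≤ err_N(t)` and bounded below; `F_N(t) := ∫₀ᵗ f_N` is continuous and satisfies
`F_N(t) ≤ α_N + C∫₀ᵗF_N` with `α_N := |f_N(0)|τ + ∫₀^τ ẽ_N⁺ → 0` (dominated convergence), so `F_N ≤ α_N e^{Ct}`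
(Grönwall for continuous functions via `d/dt (e^{−Ct}∫₀ᵗF_N) ≤ α_N e^{−Ct}`), and `f_N(t) = f_N(0) + C F_N(t) + ẽ_N(t)`. -/
theorem stub_forcedGronwall :
    ∀ (f err : ℕ → ℝ → ℝ) (τ C B : ℝ), 0 ≤ τ → 0 ≤ C →
      (∀ N, ∀ t ∈ Icc 0 τ, |f N t| ≤ B) → (∀ N, Measurable (f N)) →
      (∀ N, ∀ t ∈ Icc 0 τ, f N t ≤ f N 0 + C * (∫ s in (0:ℝ)..t, f N s) + err N t) →
      (∀ t ∈ Icc 0 τ, Tendsto (fun N => err N t) atTop (𝓝 0)) →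
      Tendsto (fun N => f N 0) atTop (𝓝 0) →
      ∀ t ∈ Icc 0 τ, ∀ ε > (0:ℝ), ∀ᶠ N in atTop, f N t ≤ ε :=
  -- LANDED p161091 (wave 3), `Theorems/BoxDissipativeWeakStrongRelativeEnergyStabilityForcedGronwall.lean`
  Summit.AtomisticToContinuum.HydrodynamicLimit.Theorems.RES.stub_forcedGronwall

/-- **S-J — hard-sphere flows have a jointly measurable version on the good set (measure theory; size S–M).**
Orbits of good points are hard-sphere trajectories, which are RIGHT-CONTINUOUS (`IsHardSphereTrajectory.tendsto_nhdsGT`,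
torus translations are continuous), and each time-`t` map is measurable; a right-continuous-in-time, measurable-in-space
map into the metrizable second-countable phase space is jointly measurable (approximate `t` from the right by dyadics:
`Ψ_k(t,z) = Φ_{⌈2ᵏt⌉/2ᵏ} z` is measurable and `→ Ψ(t,z)`; `measurable_of_tendsto_metrizable`); off the good set take
`Ψ(t,z) := z`. -/
theorem stub_flowJointMeasurable :
    ∀ (ε : ℝ) (n : ℕ) (Φ : HardSphereFlow (Literature.Analysis.FluidPDE.Torus.geometry (Fin 3)) ε n),
      ∃ Ψ : ℝ × Config n (Fin 3) T3 → Config n (Fin 3) T3, Measurable Ψ ∧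
        ∀ (t : ℝ), ∀ z ∈ Φ.good, Ψ (t, z) = Φ.flow t z :=
  -- LANDED p161332 (wave 3), `Theorems/BoxDissipativeWeakStrongRelativeEnergyStabilityFlowJointMeasurable.lean`
  Summit.AtomisticToContinuum.HydrodynamicLimit.Theorems.RES.stub_flowJointMeasurable

/-- **S-X — the clamped relative-energy Grönwall in expectation (THE HEART; size L; the lead's stub).**
Under the forced Grönwall lemma (S-G), the jointly measurable version of the flow (S-J), the balance laws (S-B), the master inequality (S-M), the energy moment bound (S-E), the route's closure
statements `FluxClosure` (K1) and `EntropyAdmissibility` (K2) and the EOS fact there is a band threshold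
`ηb > 0` such that for every band `0 < η₁ < ηb`, all continuous positive profiles and `σ < σ₀(profiles)`:
for every classical hard-sphere Euler solution on `[0,T)` with `ρσ³ ≤ η₁/2`, every flow family whose
local-Gibbs fields satisfy the `t = 0` LLN (the hypothesis under which K1/K2 deliver), every kinetic window,
every `τ ∈ [0,T)` and all clamps admissible on `[0,τ]`: clamped vanishing at `0` implies clamped vanishing
at `τ`. BF18 §3.2 in expectation over `P_N` with zero defect: `d/dt E_P∫ℰ_Z` is assembled from S-B (energy,
continuity with `φ₁ = ½|u|² − μ_cut(ρ,θ)`), K1 tested with `w = u` (momentum), K2 with `φ = θ` and `Z_{a,b}`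
(entropy, correct sign) and `∂ₜ p_cut(ρ,θ)`, giving `E_P∫ℰ_Z(τ) ≤ E_P∫ℰ_Z(0) + ∫₀^τ E_P∫ rawRHS + err_N(τ)` with
`err_N(τ) → 0` pointwise and bounded (moment bounds from S-B + S-E); `∫ rawRHS dx = ∫ reducedRHS dx`
(`rawRHS_add_div_eq`, `setIntegral_divPU_eq_zero` for the smooth band extension); S-M a.s. on
vacuum/quadrant boxes, one-particle frozen boxes by hand, multi-particle frozen boxes Liouville-null;
Grönwall with `o(1)` forcing by dominated convergence. -/
theorem stub_clampedRelEnergyGronwall :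
    (∀ (f err : ℕ → ℝ → ℝ) (τ C B : ℝ), 0 ≤ τ → 0 ≤ C →
      (∀ N, ∀ t ∈ Icc 0 τ, |f N t| ≤ B) → (∀ N, Measurable (f N)) →
      (∀ N, ∀ t ∈ Icc 0 τ, f N t ≤ f N 0 + C * (∫ s in (0:ℝ)..t, f N s) + err N t) →
      (∀ t ∈ Icc 0 τ, Tendsto (fun N => err N t) atTop (𝓝 0)) →
      Tendsto (fun N => f N 0) atTop (𝓝 0) →
      ∀ t ∈ Icc 0 τ, ∀ ε > (0:ℝ), ∀ᶠ N in atTop, f N t ≤ ε) →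
    (∀ (ε : ℝ) (n : ℕ) (Φ : HardSphereFlow (Literature.Analysis.FluidPDE.Torus.geometry (Fin 3)) ε n),
      ∃ Ψ : ℝ × Config n (Fin 3) T3 → Config n (Fin 3) T3, Measurable Ψ ∧
        ∀ (t : ℝ), ∀ z ∈ Φ.good, Ψ (t, z) = Φ.flow t z) →
    (∀ σ : ℝ, 0 < σ → ∀ (N : ℕ)
      (Φ : HardSphereFlow (Literature.Analysis.FluidPDE.Torus.geometry (Fin 3)) (hsDiameter σ N) (N + 1))
      (l : ℝ), 0 < l → l ≤ 1 → ∀ z ∈ Φ.good, BoxBalanceLawsFor σ N Φ l z) →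
    (HsEosLowDensity →
      ∃ ηm : ℝ, 0 < ηm ∧ ∀ η₁ : ℝ, 0 < η₁ → η₁ < ηm → ∀ σ : ℝ, 0 < σ → CutEosMasterFor σ η₁) →
    (∀ (a₀ θ₀ : T3 → ℝ) (u₀ : T3 → V3), Continuous a₀ → Continuous θ₀ → Continuous u₀ →
      (∀ x, 0 < a₀ x) → (∀ x, 0 < θ₀ x) → EnergyMomentFor a₀ u₀ θ₀) →
    FluxClosure → EntropyAdmissibility → HsEosLowDensity →
      ∃ ηb : ℝ, 0 < ηb ∧ ∀ η₁ : ℝ, 0 < η₁ → η₁ < ηb →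
        ∀ (a₀ θ₀ : T3 → ℝ) (u₀ : T3 → V3), Continuous a₀ → Continuous θ₀ → Continuous u₀ →
          (∀ x, 0 < a₀ x) → (∀ x, 0 < θ₀ x) →
          ∃ σ₀ : ℝ, 0 < σ₀ ∧ ∀ σ : ℝ, 0 < σ → σ < σ₀ →
            ∀ (T : ℝ) (ρ θ : ℝ → T3 → ℝ) (u : ℝ → T3 → V3), IsHardSphereEulerSolution σ T ρ u θ →
              (∀ t ∈ Ico 0 T, ∀ x, ρ t x * σ ^ 3 ≤ η₁ / 2) →
              ∀ Φ : (N : ℕ) → HardSphereFlow (Literature.Analysis.FluidPDE.Torus.geometry (Fin 3))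
                  (hsDiameter σ N) (N + 1),
                TendstoHydroFieldsAt (fun N => localGibbsLaw σ a₀ u₀ θ₀ N (Φ N)) Φ ρ u θ 0 →
                  ∀ ℓ : ℕ → ℝ, IsKineticWindow ℓ →
                    ∀ τ ∈ Ico 0 T, ∀ a b : ℝ, ClampAdmissible σ η₁ a b ρ θ τ →
                      BoxClampedRelEnergyVanishesAt σ η₁ a b a₀ u₀ θ₀ Φ ρ u θ ℓ 0 →
                        BoxClampedRelEnergyVanishesAt σ η₁ a b a₀ u₀ θ₀ Φ ρ u θ ℓ τ :=
  -- LANDED p169036 (lead, waves 3–5: Gronwall* helper files), `Theorems/BoxDissipativeWeakStrongRelativeEnergyStabilityGronwall.lean`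
  Summit.AtomisticToContinuum.HydrodynamicLimit.Theorems.RES.stub_clampedRelEnergyGronwall

/-- **S3' — the clamped box relative energy is coercive (convex analysis + measure theory; size M).**
Given the EOS fact there is a band threshold `ηd > 0` such that for every band `0 < η₁ < ηd`, continuous
positive profiles, `0 < σ ≤ 1/2`, every classical solution on `[0,T)`, every flow family, every kinetic window,
every `t ∈ [0,T)` and clamps admissible on `[0,t]`: clamped vanishing at `t` forces `TendstoHydroFieldsAt` at `t`.
Why true: pointwise and for Liouville-a.e. configuration, `ℰ_Z + C/((N+1)ℓ³)` dominates `c·min(dev², dev)` of the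
box deviations `|ρ̂−ρ| + ‖m̂−ρu‖ + |Ê−E|`: on `{ŝ ≥ a}` (quadrant) `ℰ_Z ≥ relEnergyFull_cut` with the explicit
Bregman / `x−1−log x` coercivity of the monatomic cut law (`(ηZ_cut)' > 0` for `η₁ < ηd`), on `{ŝ < a}` the deep
clamp gives `ℰ_Z ≥ ½ρ̂|v̂−u|² + 3/2ρ̂θ̂ + ρ̂ + p_cut(ρ,θ)`, vacuum costs `p_cut(ρ,θ) ≥ p_min`, frozen boxes with
≥ 2 particles are Liouville-null (the flow preserves Liouville, `P_N ≪ Liouville`), one-particle boxes have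
`ρ̂ = ((N+1)ℓ³)⁻¹ → 0`; Markov gives the box fields in `L¹(dx)` in probability; then
`|⟨U_N, χ⟩ − ∫ Û_N χ dx| ≤ ω_χ(ℓ√3/2)·(1, (N+1)⁻¹Σ|vᵢ|, KE/(N+1))` by uniform continuity of `χ` (`∫ K_l(x,y) dx = 1`),
the velocity sums controlled by `∫Ê dx`, itself close to `∫E(t)` in probability. -/
theorem stub_clampedRelEnergyCoercive :
    HsEosLowDensity →
      ∃ ηd : ℝ, 0 < ηd ∧ ∀ η₁ : ℝ, 0 < η₁ → η₁ < ηd →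
        ∀ (a₀ θ₀ : T3 → ℝ) (u₀ : T3 → V3), Continuous a₀ → Continuous θ₀ → Continuous u₀ →
          (∀ x, 0 < a₀ x) → (∀ x, 0 < θ₀ x) →
          ∀ σ : ℝ, 0 < σ → σ ≤ 1 / 2 →
            ∀ (T : ℝ) (ρ θ : ℝ → T3 → ℝ) (u : ℝ → T3 → V3), IsHardSphereEulerSolution σ T ρ u θ →
              ∀ Φ : (N : ℕ) → HardSphereFlow (Literature.Analysis.FluidPDE.Torus.geometry (Fin 3))
                  (hsDiameter σ N) (N + 1),
                ∀ ℓ : ℕ → ℝ, IsKineticWindow ℓ →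
                  ∀ t ∈ Ico 0 T, ∀ a b : ℝ, ClampAdmissible σ η₁ a b ρ θ t →
                    BoxClampedRelEnergyVanishesAt σ η₁ a b a₀ u₀ θ₀ Φ ρ u θ ℓ t →
                      TendstoHydroFieldsAt (fun N => localGibbsLaw σ a₀ u₀ θ₀ N (Φ N)) Φ ρ u θ t :=
  -- LANDED p159980 (+ helpers p159371 p159426 p159514 p159780; wave 1), `Theorems/BoxDissipativeWeakStrongRelativeEnergyStabilityCoercive.lean`
  Summit.AtomisticToContinuum.HydrodynamicLimit.Theorems.RES.stub_clampedRelEnergyCoercive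

/-! ## §2 Composition (sorry-free) -/

/-- **A kinetic window exists**: `ℓ_N = (N+1)^{-1/4}` satisfies `0 < ℓ_N ≤ 1`, `ℓ_N → 0` and
`(N+1)ℓ_N³ = (N+1)^{1/4} → ∞`. -/
theorem exists_isKineticWindow : ∃ ℓ : ℕ → ℝ, IsKineticWindow ℓ := by
  refine ⟨fun N => ((N : ℝ) + 1) ^ (-(1 / 4 : ℝ)), fun N => ⟨?_, ?_⟩, ?_, ?_⟩
  · exact Real.rpow_pos_of_pos (by positivity) _
  · exact Real.rpow_le_one_of_one_le_of_nonpos (by simp) (by norm_num)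
  · have h1 : Tendsto (fun N : ℕ => (N : ℝ) + 1) atTop atTop :=
      tendsto_atTop_add_const_right _ 1 tendsto_natCast_atTop_atTop
    exact (tendsto_rpow_neg_atTop (by norm_num : (0 : ℝ) < 1 / 4)).comp h1
  · have h1 : Tendsto (fun N : ℕ => (N : ℝ) + 1) atTop atTop :=
      tendsto_atTop_add_const_right _ 1 tendsto_natCast_atTop_atTop
    have h2 : Tendsto (fun N : ℕ => ((N : ℝ) + 1) ^ (1 / 4 : ℝ)) atTop atTop :=
      (tendsto_rpow_atTop (by norm_num : (0 : ℝ) < 1 / 4)).comp h1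
    refine h2.congr' (Eventually.of_forall fun N => ?_)
    have hx : (0 : ℝ) < (N : ℝ) + 1 := by positivity
    simp only
    rw [← Real.rpow_natCast (((N : ℝ) + 1) ^ (-(1 / 4 : ℝ))) 3, ← Real.rpow_mul hx.le,
      ← Real.rpow_add_one hx.ne']
    norm_num

/-- **The line closes the crux modulo its stubs**: `RelativeEnergyStability` BY NAME from the stubs (used as
hypotheses through their declared statements). Real content: the common band threshold
`min ηe (min ηa (min ηb ηd))` (S-B, S-M, S-E are consumed by S-X), the common density threshold
`min (1/2) (min σK σ₂)` with `σK` from the crux's OWN inlined `LocalGibbsFineScale` antecedent, `0 < T` from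
`t ∈ [0,T)`, a kinetic window (`exists_isKineticWindow`), admissible clamps on `[0,t]` from S0 (restricted to
`[0,0]` for S1' by `clampAdmissible_mono`), and the chaining S3' ∘ S-X ∘ S1' ∘ K0 at each `t`. -/
theorem RelativeEnergyStability_of
    (hmono : ∀ {σ η₁ a b : ℝ} {ρ θ : ℝ → T3 → ℝ} {τ τ' : ℝ},
      ClampAdmissible σ η₁ a b ρ θ τ → τ' ≤ τ → ClampAdmissible σ η₁ a b ρ θ τ')
    (h₀ : HsEosLowDensity →
      ∃ ηe : ℝ, 0 < ηe ∧ ∀ η₁ : ℝ, 0 < η₁ → η₁ < ηe → ∀ σ : ℝ, 0 < σ →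
        ∀ (T : ℝ) (ρ θ : ℝ → T3 → ℝ) (u : ℝ → T3 → V3), IsHardSphereEulerSolution σ T ρ u θ →
          (∀ t ∈ Ico 0 T, ∀ x, ρ t x * σ ^ 3 ≤ η₁ / 2) →
          ∀ τ ∈ Ico 0 T, ∃ a b : ℝ, ClampAdmissible σ η₁ a b ρ θ τ)
    (h₁ : HsEosLowDensity →
      ∃ ηa : ℝ, 0 < ηa ∧ ∀ η₁ : ℝ, 0 < η₁ → η₁ < ηa →
        ∀ (a₀ θ₀ : T3 → ℝ) (u₀ : T3 → V3), Continuous a₀ → Continuous θ₀ → Continuous u₀ →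
          (∀ x, 0 < a₀ x) → (∀ x, 0 < θ₀ x) →
          ∀ σ : ℝ, 0 < σ → σ ≤ 1 / 2 →
            ∀ (T : ℝ) (ρ θ : ℝ → T3 → ℝ) (u : ℝ → T3 → V3), IsHardSphereEulerSolution σ T ρ u θ → 0 < T →
              ∀ Φ : (N : ℕ) → HardSphereFlow (Literature.Analysis.FluidPDE.Torus.geometry (Fin 3))
                  (hsDiameter σ N) (N + 1),
                ∀ ℓ : ℕ → ℝ, IsKineticWindow ℓ →
                  ∀ a b : ℝ, ClampAdmissible σ η₁ a b ρ θ 0 →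
                    BoxFieldsL1At σ a₀ u₀ θ₀ Φ ρ u θ ℓ 0 →
                      BoxClampedRelEnergyVanishesAt σ η₁ a b a₀ u₀ θ₀ Φ ρ u θ ℓ 0)
    (hB : ∀ σ : ℝ, 0 < σ → ∀ (N : ℕ)
      (Φ : HardSphereFlow (Literature.Analysis.FluidPDE.Torus.geometry (Fin 3)) (hsDiameter σ N) (N + 1))
      (l : ℝ), 0 < l → l ≤ 1 → ∀ z ∈ Φ.good, BoxBalanceLawsFor σ N Φ l z)
    (hM : HsEosLowDensity →
      ∃ ηm : ℝ, 0 < ηm ∧ ∀ η₁ : ℝ, 0 < η₁ → η₁ < ηm → ∀ σ : ℝ, 0 < σ → CutEosMasterFor σ η₁)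
    (hE : ∀ (a₀ θ₀ : T3 → ℝ) (u₀ : T3 → V3), Continuous a₀ → Continuous θ₀ → Continuous u₀ →
      (∀ x, 0 < a₀ x) → (∀ x, 0 < θ₀ x) → EnergyMomentFor a₀ u₀ θ₀)
    (hG : (∀ (f err : ℕ → ℝ → ℝ) (τ C B : ℝ), 0 ≤ τ → 0 ≤ C →
        (∀ N, ∀ t ∈ Icc 0 τ, |f N t| ≤ B) → (∀ N, Measurable (f N)) →
        (∀ N, ∀ t ∈ Icc 0 τ, f N t ≤ f N 0 + C * (∫ s in (0:ℝ)..t, f N s) + err N t) →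
        (∀ t ∈ Icc 0 τ, Tendsto (fun N => err N t) atTop (𝓝 0)) →
        Tendsto (fun N => f N 0) atTop (𝓝 0) →
        ∀ t ∈ Icc 0 τ, ∀ ε > (0:ℝ), ∀ᶠ N in atTop, f N t ≤ ε))
    (hJ : (∀ (ε : ℝ) (n : ℕ) (Φ : HardSphereFlow (Literature.Analysis.FluidPDE.Torus.geometry (Fin 3)) ε n),
        ∃ Ψ : ℝ × Config n (Fin 3) T3 → Config n (Fin 3) T3, Measurable Ψ ∧
          ∀ (t : ℝ), ∀ z ∈ Φ.good, Ψ (t, z) = Φ.flow t z))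
    (h₂ : (∀ (f err : ℕ → ℝ → ℝ) (τ C B : ℝ), 0 ≤ τ → 0 ≤ C →
        (∀ N, ∀ t ∈ Icc 0 τ, |f N t| ≤ B) → (∀ N, Measurable (f N)) →
        (∀ N, ∀ t ∈ Icc 0 τ, f N t ≤ f N 0 + C * (∫ s in (0:ℝ)..t, f N s) + err N t) →
        (∀ t ∈ Icc 0 τ, Tendsto (fun N => err N t) atTop (𝓝 0)) →
        Tendsto (fun N => f N 0) atTop (𝓝 0) →
        ∀ t ∈ Icc 0 τ, ∀ ε > (0:ℝ), ∀ᶠ N in atTop, f N t ≤ ε) →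
      (∀ (ε : ℝ) (n : ℕ) (Φ : HardSphereFlow (Literature.Analysis.FluidPDE.Torus.geometry (Fin 3)) ε n),
        ∃ Ψ : ℝ × Config n (Fin 3) T3 → Config n (Fin 3) T3, Measurable Ψ ∧
          ∀ (t : ℝ), ∀ z ∈ Φ.good, Ψ (t, z) = Φ.flow t z) →
      (∀ σ : ℝ, 0 < σ → ∀ (N : ℕ)
        (Φ : HardSphereFlow (Literature.Analysis.FluidPDE.Torus.geometry (Fin 3)) (hsDiameter σ N) (N + 1))
        (l : ℝ), 0 < l → l ≤ 1 → ∀ z ∈ Φ.good, BoxBalanceLawsFor σ N Φ l z) →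
      (HsEosLowDensity →
        ∃ ηm : ℝ, 0 < ηm ∧ ∀ η₁ : ℝ, 0 < η₁ → η₁ < ηm → ∀ σ : ℝ, 0 < σ → CutEosMasterFor σ η₁) →
      (∀ (a₀ θ₀ : T3 → ℝ) (u₀ : T3 → V3), Continuous a₀ → Continuous θ₀ → Continuous u₀ →
        (∀ x, 0 < a₀ x) → (∀ x, 0 < θ₀ x) → EnergyMomentFor a₀ u₀ θ₀) →
      FluxClosure → EntropyAdmissibility → HsEosLowDensity →
        ∃ ηb : ℝ, 0 < ηb ∧ ∀ η₁ : ℝ, 0 < η₁ → η₁ < ηb →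
          ∀ (a₀ θ₀ : T3 → ℝ) (u₀ : T3 → V3), Continuous a₀ → Continuous θ₀ → Continuous u₀ →
            (∀ x, 0 < a₀ x) → (∀ x, 0 < θ₀ x) →
            ∃ σ₀ : ℝ, 0 < σ₀ ∧ ∀ σ : ℝ, 0 < σ → σ < σ₀ →
              ∀ (T : ℝ) (ρ θ : ℝ → T3 → ℝ) (u : ℝ → T3 → V3), IsHardSphereEulerSolution σ T ρ u θ →
                (∀ t ∈ Ico 0 T, ∀ x, ρ t x * σ ^ 3 ≤ η₁ / 2) →
                ∀ Φ : (N : ℕ) → HardSphereFlow (Literature.Analysis.FluidPDE.Torus.geometry (Fin 3))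
                    (hsDiameter σ N) (N + 1),
                  TendstoHydroFieldsAt (fun N => localGibbsLaw σ a₀ u₀ θ₀ N (Φ N)) Φ ρ u θ 0 →
                    ∀ ℓ : ℕ → ℝ, IsKineticWindow ℓ →
                      ∀ τ ∈ Ico 0 T, ∀ a b : ℝ, ClampAdmissible σ η₁ a b ρ θ τ →
                        BoxClampedRelEnergyVanishesAt σ η₁ a b a₀ u₀ θ₀ Φ ρ u θ ℓ 0 →
                          BoxClampedRelEnergyVanishesAt σ η₁ a b a₀ u₀ θ₀ Φ ρ u θ ℓ τ)
    (h₃ : HsEosLowDensity →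
      ∃ ηd : ℝ, 0 < ηd ∧ ∀ η₁ : ℝ, 0 < η₁ → η₁ < ηd →
        ∀ (a₀ θ₀ : T3 → ℝ) (u₀ : T3 → V3), Continuous a₀ → Continuous θ₀ → Continuous u₀ →
          (∀ x, 0 < a₀ x) → (∀ x, 0 < θ₀ x) →
          ∀ σ : ℝ, 0 < σ → σ ≤ 1 / 2 →
            ∀ (T : ℝ) (ρ θ : ℝ → T3 → ℝ) (u : ℝ → T3 → V3), IsHardSphereEulerSolution σ T ρ u θ →
              ∀ Φ : (N : ℕ) → HardSphereFlow (Literature.Analysis.FluidPDE.Torus.geometry (Fin 3))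
                  (hsDiameter σ N) (N + 1),
                ∀ ℓ : ℕ → ℝ, IsKineticWindow ℓ →
                  ∀ t ∈ Ico 0 T, ∀ a b : ℝ, ClampAdmissible σ η₁ a b ρ θ t →
                    BoxClampedRelEnergyVanishesAt σ η₁ a b a₀ u₀ θ₀ Φ ρ u θ ℓ t →
                      TendstoHydroFieldsAt (fun N => localGibbsLaw σ a₀ u₀ θ₀ N (Φ N)) Φ ρ u θ t) :
    BoxDissipativeWeakStrong.RelativeEnergyStability := by
  intro hFC hEA hK0 hEos
  obtain ⟨ηe, hηe, H₀⟩ := h₀ hEos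
  obtain ⟨ηa, hηa, H₁⟩ := h₁ hEos
  obtain ⟨ηb, hηb, H₂⟩ := h₂ hG hJ hB hM hE hFC hEA hEos
  obtain ⟨ηd, hηd, H₃⟩ := h₃ hEos
  refine ⟨min ηe (min ηa (min ηb ηd)), lt_min hηe (lt_min hηa (lt_min hηb hηd)), ?_⟩
  intro η₁ hη₁ hη₁lt a₀ θ₀ u₀ ha hθ hu hap hθp
  have hη₁e : η₁ < ηe := lt_of_lt_of_le hη₁lt (min_le_left _ _)
  have hη₁a : η₁ < ηa := lt_of_lt_of_le hη₁lt ((min_le_right _ _).trans (min_le_left _ _))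
  have hη₁b : η₁ < ηb :=
    lt_of_lt_of_le hη₁lt ((min_le_right _ _).trans ((min_le_right _ _).trans (min_le_left _ _)))
  have hη₁d : η₁ < ηd :=
    lt_of_lt_of_le hη₁lt ((min_le_right _ _).trans ((min_le_right _ _).trans (min_le_right _ _)))
  obtain ⟨σK, hσK, GK⟩ := hK0 a₀ θ₀ u₀ ha hθ hu hap hθp
  obtain ⟨σ₂, hσ₂, G₂⟩ := H₂ η₁ hη₁ hη₁b a₀ θ₀ u₀ ha hθ hu hap hθp
  refine ⟨min (1 / 2) (min σK σ₂), lt_min one_half_pos (lt_min hσK hσ₂), ?_⟩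
  intro σ hσ hσlt T ρ θ u hsol hguard Φ h0 t ht
  have hσhalf : σ ≤ 1 / 2 := (lt_of_lt_of_le hσlt (min_le_left _ _)).le
  have hσK' : σ < σK := lt_of_lt_of_le hσlt ((min_le_right _ _).trans (min_le_left _ _))
  have hσ₂' : σ < σ₂ := lt_of_lt_of_le hσlt ((min_le_right _ _).trans (min_le_right _ _))
  have hT : 0 < T := lt_of_le_of_lt ht.1 ht.2
  obtain ⟨ℓ, hℓ⟩ := exists_isKineticWindow
  -- admissible deep clamps on `[0,t]` (S0), restricted to `[0,0]` for the statics
  obtain ⟨a, b, hab⟩ := H₀ η₁ hη₁ hη₁e σ hσ T ρ θ u hsol hguard t ht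
  have hab0 : ClampAdmissible σ η₁ a b ρ θ 0 := hmono hab ht.1
  -- the crux's own fine-scale LLN antecedent (K0), at this window
  have hL1 : BoxFieldsL1At σ a₀ u₀ θ₀ Φ ρ u θ ℓ 0 :=
    GK σ hσ hσK' T ρ θ u hsol hT Φ h0 ℓ hℓ.1 hℓ.2.1 hℓ.2.2
  -- S1': statics by dominated convergence at t = 0
  have h0rel : BoxClampedRelEnergyVanishesAt σ η₁ a b a₀ u₀ θ₀ Φ ρ u θ ℓ 0 :=
    H₁ η₁ hη₁ hη₁a a₀ θ₀ u₀ ha hθ hu hap hθp σ hσ hσhalf T ρ θ u hsol hT Φ ℓ hℓ a b hab0 hL1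
  -- S-X: BF18 clamped Grönwall in expectation
  have htrel : BoxClampedRelEnergyVanishesAt σ η₁ a b a₀ u₀ θ₀ Φ ρ u θ ℓ t :=
    G₂ σ hσ hσ₂' T ρ θ u hsol hguard Φ h0 ℓ hℓ t ht a b hab h0rel
  -- S3': coercivity
  exact H₃ η₁ hη₁ hη₁d a₀ θ₀ u₀ ha hθ hu hap hθp σ hσ hσhalf T ρ θ u hsol Φ ℓ hℓ t ht a b hab htrel

/-- The skeleton instantiated: the crux modulo the registered stubs. -/
theorem RelativeEnergyStability_skeleton : BoxDissipativeWeakStrong.RelativeEnergyStability :=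
  RelativeEnergyStability_of (fun h hτ => clampAdmissible_mono h hτ) stub_clampChoice
    stub_clampedRelEnergyTimeZero stub_boxBalanceLaws stub_cutEosMaster stub_localGibbsEnergyMoment
    stub_forcedGronwall stub_flowJointMeasurable stub_clampedRelEnergyGronwall stub_clampedRelEnergyCoercive

end Summit.AtomisticToContinuum.HydrodynamicLimit.Cruxes.RelativeEnergyStability.Birth

end
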